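import Summits.Ventures.LatticeQCDFlow.Scaling.ApproximateEigenfunctionFloor
import Summits.Ventures.LatticeQCDFlow.Scaling.PersistentPairEigenfunction
import Summits.Ventures.LatticeQCDFlow.Scaling.LumpedStarPairLumping

/-!
HONEST FRAMING: exact (Metropolis-corrected) sampling algorithms for lattice gauge theory; figures
of merit are autocorrelation/cost numbers at stated couplings and volumes; no continuum-physics
claim.

# PersistentPairMeanDecay — THE UNIT IS EXACT FOR THE OBSERVABLE: UNDER THE PATTERN, THE PAIR STATISTIC `Φ = (G − g⋆K)e^{γ(G−g⋆K)/K} + 𝟙{hub=u}κ(G)` OF THE LUMPED STAR'S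
# STEP CHAIN HAS **`|E_xΦ(X_n) − (1 − Λ/K)ⁿΦ(x)| ≤ 4c(1+c)e^c/Λ`** FOR EVERY START AND EVERY `n`, AND `|E_{π}Φ| ≤ 4c(1+c)e^c/Λ` UNDER EVERY STATIONARY LAW — THE COLD `u`-COUNT MODE
# RELAXES AT THE RATE `Λ/K` EXACTLY, UP TO AN `O(1)` SHIFT (lean-2 GEN-46, ours)

Venture-side (OURS).  Cell `lqcd-flow` (pub-lqcd), unit `pub-lqcd-lean-2-g46`, 2026-08-31.  Chapter AF (the law-free `½·log K` with persistence), file 8 — the two-sided companion of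
file 5's floor for the OBSERVABLE: file 1's mean estimate `|E_xΦ(X_t) − λᵗΦ(x)| ≤ δ/(1−λ)` (both directions) with file 4's defect (`δ = 4c(1+c)e^c/K`, `1 − λ = Λ/K`) for X5's step
chain `S = σA + (1−σ)B` under the pattern `acc(u,v) = α`, `acc(v,u) = β` off `u`; constants `c̄ = pα + (1−p)β` (`p = μ_0(u)`), `g⋆ = pα/c̄`, `D₀ = (1−σ) + σαβ/c̄`, `Λ = σ(1−σ)c̄/D₀`,
`γ = σ(β−α)/D₀`, `c = σ/D₀`.  Since `|Φ(x) − (G(x) − g⋆K)| ≤ K(e^c − 1) + ce^c` only for small `c`, the statement is kept for `Φ` itself: from the `u`-crowded composition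
`E_xΦ(X_n) ≥ (1−Λ/K)ⁿK(1−g⋆)e^{−c} − 4c(1+c)e^c/Λ` stays of order `K` for `n ≪ K/Λ` and is `O(1)` for `n ≫ K/Λ` — the relaxation time of the slow mode is `K/Λ` from both sides.
Hypothesis-equations only, no definitions.

* **`persistentPair_lawMean_decay`** (the two-sided mean estimate along X5's step chain, `S` row-stochastic), **`persistentPair_lawMean_stationary`** (`|E_πΦ| ≤ 4c(1+c)e^c/Λ` for every
  stationary probability vector `π` of `S`).

Reading (no numerics implied): with file 5 — the same statistic certifies `t_mix ≥ (K/Λ − 1)(½·log K − log C)` — the picture is the standard one: the slow mode decorrelates in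
`Θ(K/Λ)` steps while mixing in total variation needs the extra `½·log K` (toy `numerics46/pair_tmix_toy.py`, nothing claimed).  Literature grade (cell rule): OWN corollary of
files 1, 3, 4; nothing cited; no new bib keys.
-/

noncomputable section

open Finset Function
open Literature.Probability.MarkovChains

namespace Summit.Ventures.LatticeQCDFlow.Scaling

section MeanDecay
variable {X : Type*} [Fintype X] [DecidableEq X] {S : Type*} [Fintype S] [DecidableEq S]
variable {hub : X → S} {comp : X → S → ℕ} {K : ℕ} {μ0 W : S → ℝ} {σ : ℝ} {acc : S → S → ℝ} {Kh : (S → ℕ) → S → S → ℝ}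
variable {Ast Bst Sst : X → X → ℝ} {u : S} {α β : ℝ} {Gc : X → ℕ} {f κ : ℕ → ℝ} {Φ : X → ℝ}

/-- **THE SLOW MODE RELAXES AT THE RATE `Λ/K` FROM BOTH SIDES:** X5's step chain `S = σA + (1−σ)B` (`0 < σ < 1`, `σ ≤ (1−σ)K`, `K ≥ 1`, `W > 0`, `Σμ_0 = 1`, `0 < μ_0(u) < 1`),
the pattern `acc(u,v) = α`, `acc(v,u) = β` off `u` (`α, β ∈ (0,1]`), the statistic `Φ(x) = f(G x) + 𝟙{hub x = u}κ(G x)` of file 3 on the cold `u`-count `G`: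
**`|E_xΦ(X_n) − (1 − Λ/K)ⁿΦ(x)| ≤ 4c(1+c)e^c/Λ`** for every `x` and `n`. [ours] -/
theorem persistentPair_lawMean_decay (hinj : ∀ x x', hub x = hub x' → comp x = comp x' → x = x')
    (hsurj : ∀ (z : S) (N : S → ℕ), ∑ v, N v = K + 1 → N z ≠ 0 → ∃ x, hub x = z ∧ comp x = N) (hhub : ∀ x, comp x (hub x) ≠ 0)
    (hsum : ∀ x, ∑ v, comp x v = K + 1) (hK : 1 ≤ K) (hW : ∀ v, 0 < W v) (hacc : ∀ h v, acc h v = min 1 (W h / W v)) (hμ1 : ∑ v, μ0 v = 1) (hμ0 : ∀ v, 0 ≤ μ0 v)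
    (hp0 : 0 < μ0 u) (hp1 : μ0 u < 1) (hσ0 : 0 < σ) (hσ1 : σ < 1) (hKσ : σ ≤ (1 - σ) * K)
    (hKoff : ∀ N h v, h ≠ v → Kh N h v = if N h = 0 then 0 else (N v : ℝ) / K * acc h v) (hKdiag : ∀ N h, Kh N h h = 1 - ∑ v ∈ univ.erase h, Kh N h v)
    (hA : ∀ x x', Ast x x' = if comp x' = comp x then Kh (comp x) (hub x) (hub x') else 0)
    (hB : ∀ x x', Bst x x' = μ0 (hub x') * (if comp x' + Pi.single (hub x) 1 = comp x + Pi.single (hub x') 1 then 1 else 0))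
    (hS : ∀ x x', Sst x x' = σ * Ast x x' + (1 - σ) * Bst x x')
    (hα0 : 0 < α) (hα1 : α ≤ 1) (hβ0 : 0 < β) (hβ1 : β ≤ 1) (hαu : ∀ v, v ≠ u → acc u v = α) (hβu : ∀ v, v ≠ u → acc v u = β)
    {cbar gs D0 Λ γ c : ℝ} (hcbar : cbar = μ0 u * α + (1 - μ0 u) * β) (hgs : gs = μ0 u * α / cbar) (hD0 : D0 = (1 - σ) + σ * α * β / cbar)
    (hΛ : Λ = σ * (1 - σ) * cbar / D0) (hγ : γ = σ * (β - α) / D0) (hc : c = σ / D0)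
    (hf : ∀ G : ℕ, f G = ((G : ℝ) - gs * K) * Real.exp (γ * (((G : ℝ) - gs * K) / K)))
    (hκ : ∀ G : ℕ, κ G = c * ((α * ((K : ℝ) - G) + β * G) / K) * Real.exp (γ * (((G : ℝ) - gs * K) / K)))
    (hG : ∀ x, Gc x = comp x u - (if hub x = u then 1 else 0)) (hΦ : ∀ x, Φ x = f (Gc x) + (if hub x = u then κ (Gc x) else 0)) (x : X) (n : ℕ) :
    |lawMean (lawAt Sst (Pi.single x 1) n) Φ - (1 - Λ / K) ^ n * Φ x| ≤ 4 * c * (1 + c) * Real.exp c / Λ := by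
  have hK0 : (0 : ℝ) < K := by exact_mod_cast (show 0 < K by omega)
  have hcc := pairEigen_c_bounds hσ0 hσ1 hα0 hα1 hβ0 hβ1 hp0 hp1 hcbar hD0 hc
  have hΛb := pairEigen_Λ_bounds hσ0 hσ1 hα0 hα1 hβ0 hβ1 hp0 hp1 hcbar hD0 hΛ hc
  have hcK : c ≤ K := by
    have h1 : σ / (1 - σ) ≤ K := by rw [div_le_iff₀ (by linarith)]; linarith
    exact le_trans hcc.2 h1
  -- the chain is row-stochastic
  have hA0 : ∀ x x', 0 ≤ Ast x x' := starStep_swap_nonneg hW hacc hK hsum hKoff hKdiag hA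
  have hA1 : ∀ x, ∑ x', Ast x x' = 1 := starStep_swap_rowsum hinj hsurj hhub hsum hKoff hKdiag hA
  have hB0 : ∀ x x', 0 ≤ Bst x x' := fun x x' => by rw [hB]; exact mul_nonneg (hμ0 _) (by split_ifs <;> norm_num)
  have hB1 : ∀ x, ∑ x', Bst x x' = 1 := starStep_redraw_rowsum hinj hsurj hhub hsum hμ1 hB
  have hSrs : IsRowStochastic Sst := by
    refine ⟨fun x y => by rw [hS]; exact add_nonneg (mul_nonneg hσ0.le (hA0 x y)) (mul_nonneg (by linarith) (hB0 x y)), fun x => ?_⟩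
    simp_rw [hS]; rw [sum_add_distrib, ← mul_sum, ← mul_sum, hA1, hB1]; ring
  -- the defect (files 3, 4)
  have hE1 : ∀ G : ℕ, G ≤ K → |σ * α * (((K : ℝ) - G) / K) * (f (G + 1) - f G - κ G) - (1 - σ) * (1 - μ0 u) * κ G + Λ / K * (f G + κ G)| ≤ 4 * c * (1 + c) * Real.exp c / K :=
    fun G hGK => pairEigen_defect_one hσ0 hσ1 hα0 hα1 hβ0 hβ1 hp0 hp1 hcbar hgs hD0 hΛ hγ hc hf hκ hK hcK hGK
  have hE0 : ∀ G : ℕ, G ≤ K → |σ * β * ((G : ℝ) / K) * (f (G - 1) + κ (G - 1) - f G) + (1 - σ) * μ0 u * κ G + Λ / K * f G| ≤ 4 * c * (1 + c) * Real.exp c / K :=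
    fun G hGK => pairEigen_defect_zero hσ0 hσ1 hα0 hα1 hβ0 hβ1 hp0 hp1 hcbar hgs hD0 hΛ hγ hc hf hκ hK hcK hGK
  have hdef : ∀ y, |∑ z, Sst y z * Φ z - (1 - Λ / K) * Φ y| ≤ 4 * c * (1 + c) * Real.exp c / K :=
    fun y => pair_step_defect hinj hsurj hhub hsum hμ1 hKoff hKdiag hA hB hS hαu hβu hG hΦ hE1 hE0 y
  -- file 1's mean estimate
  have hK1 : (1 : ℝ) ≤ K := by exact_mod_cast hK
  have hΛK : Λ / K < 1 := by rw [div_lt_one hK0]; linarith [hΛb.2.2]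
  have hlam0 : 0 ≤ 1 - Λ / K := by linarith
  have hlam1 : 1 - Λ / K < 1 := by have := div_pos hΛb.1 hK0; linarith
  have h := approxEigen_lawMean_lawAt hSrs hdef hlam0 hlam1 x n
  have e : 4 * c * (1 + c) * Real.exp c / K / (1 - (1 - Λ / K)) = 4 * c * (1 + c) * Real.exp c / Λ := by
    field_simp [hΛb.1.ne', hK0.ne']
    ring
  rw [e] at h
  exact h

omit [DecidableEq X] in
/-- **AND UNDER EVERY STATIONARY PROBABILITY VECTOR `π` OF THE STEP CHAIN, `|E_πΦ| ≤ 4c(1+c)e^c/Λ`** (the equilibrium value of the slow mode is `O(1)`, not `O(K)`). [ours] -/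
theorem persistentPair_lawMean_stationary (hinj : ∀ x x', hub x = hub x' → comp x = comp x' → x = x')
    (hsurj : ∀ (z : S) (N : S → ℕ), ∑ v, N v = K + 1 → N z ≠ 0 → ∃ x, hub x = z ∧ comp x = N) (hhub : ∀ x, comp x (hub x) ≠ 0)
    (hsum : ∀ x, ∑ v, comp x v = K + 1) (hK : 1 ≤ K) (hμ1 : ∑ v, μ0 v = 1)
    (hp0 : 0 < μ0 u) (hp1 : μ0 u < 1) (hσ0 : 0 < σ) (hσ1 : σ < 1) (hKσ : σ ≤ (1 - σ) * K)
    (hKoff : ∀ N h v, h ≠ v → Kh N h v = if N h = 0 then 0 else (N v : ℝ) / K * acc h v) (hKdiag : ∀ N h, Kh N h h = 1 - ∑ v ∈ univ.erase h, Kh N h v)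
    (hA : ∀ x x', Ast x x' = if comp x' = comp x then Kh (comp x) (hub x) (hub x') else 0)
    (hB : ∀ x x', Bst x x' = μ0 (hub x') * (if comp x' + Pi.single (hub x) 1 = comp x + Pi.single (hub x') 1 then 1 else 0))
    (hS : ∀ x x', Sst x x' = σ * Ast x x' + (1 - σ) * Bst x x')
    (hα0 : 0 < α) (hα1 : α ≤ 1) (hβ0 : 0 < β) (hβ1 : β ≤ 1) (hαu : ∀ v, v ≠ u → acc u v = α) (hβu : ∀ v, v ≠ u → acc v u = β)
    {cbar gs D0 Λ γ c : ℝ} (hcbar : cbar = μ0 u * α + (1 - μ0 u) * β) (hgs : gs = μ0 u * α / cbar) (hD0 : D0 = (1 - σ) + σ * α * β / cbar)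
    (hΛ : Λ = σ * (1 - σ) * cbar / D0) (hγ : γ = σ * (β - α) / D0) (hc : c = σ / D0)
    (hf : ∀ G : ℕ, f G = ((G : ℝ) - gs * K) * Real.exp (γ * (((G : ℝ) - gs * K) / K)))
    (hκ : ∀ G : ℕ, κ G = c * ((α * ((K : ℝ) - G) + β * G) / K) * Real.exp (γ * (((G : ℝ) - gs * K) / K)))
    (hG : ∀ x, Gc x = comp x u - (if hub x = u then 1 else 0)) (hΦ : ∀ x, Φ x = f (Gc x) + (if hub x = u then κ (Gc x) else 0))
    {π : X → ℝ} (hπ0 : ∀ x, 0 ≤ π x) (hπ1 : ∑ x, π x = 1) (hst : IsStationary π Sst) :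
    |lawMean π Φ| ≤ 4 * c * (1 + c) * Real.exp c / Λ := by
  have hK0 : (0 : ℝ) < K := by exact_mod_cast (show 0 < K by omega)
  have hcc := pairEigen_c_bounds hσ0 hσ1 hα0 hα1 hβ0 hβ1 hp0 hp1 hcbar hD0 hc
  have hΛb := pairEigen_Λ_bounds hσ0 hσ1 hα0 hα1 hβ0 hβ1 hp0 hp1 hcbar hD0 hΛ hc
  have hcK : c ≤ K := by
    have h1 : σ / (1 - σ) ≤ K := by rw [div_le_iff₀ (by linarith)]; linarith
    exact le_trans hcc.2 h1
  have hE1 : ∀ G : ℕ, G ≤ K → |σ * α * (((K : ℝ) - G) / K) * (f (G + 1) - f G - κ G) - (1 - σ) * (1 - μ0 u) * κ G + Λ / K * (f G + κ G)| ≤ 4 * c * (1 + c) * Real.exp c / K :=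
    fun G hGK => pairEigen_defect_one hσ0 hσ1 hα0 hα1 hβ0 hβ1 hp0 hp1 hcbar hgs hD0 hΛ hγ hc hf hκ hK hcK hGK
  have hE0 : ∀ G : ℕ, G ≤ K → |σ * β * ((G : ℝ) / K) * (f (G - 1) + κ (G - 1) - f G) + (1 - σ) * μ0 u * κ G + Λ / K * f G| ≤ 4 * c * (1 + c) * Real.exp c / K :=
    fun G hGK => pairEigen_defect_zero hσ0 hσ1 hα0 hα1 hβ0 hβ1 hp0 hp1 hcbar hgs hD0 hΛ hγ hc hf hκ hK hcK hGK
  have hdef : ∀ y, |∑ z, Sst y z * Φ z - (1 - Λ / K) * Φ y| ≤ 4 * c * (1 + c) * Real.exp c / K :=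
    fun y => pair_step_defect hinj hsurj hhub hsum hμ1 hKoff hKdiag hA hB hS hαu hβu hG hΦ hE1 hE0 y
  have hlam1 : 1 - Λ / K < 1 := by have := div_pos hΛb.1 hK0; linarith
  have h := approxEigen_lawMean_stationary hdef hlam1 hπ0 hπ1 hst
  have e : 4 * c * (1 + c) * Real.exp c / K / (1 - (1 - Λ / K)) = 4 * c * (1 + c) * Real.exp c / Λ := by
    field_simp [hΛb.1.ne', hK0.ne']
    ring
  rw [e] at h
  exact h

end MeanDecay

end Summit.Ventures.LatticeQCDFlow.Scaling

end
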